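import Summits.Ventures.PackingBounds.Energy.TenPointCkSeven
import Summits.Ventures.PackingBounds.Energy.TenPointPetQ1
import Summits.Ventures.PackingBounds.Energy.TenPointPetQ2
import Summits.Ventures.PackingBounds.Energy.TenPointPetQ3
import Summits.Ventures.PackingBounds.Energy.NewtonCertificate
import Summits.Ventures.PackingBounds.Configurations.PetersenCodeUnique
import Summits.Ventures.PackingBounds.Energy.TenPointCkSevenUnique
import HarnessLib

/-!
# Ten points on `S³`: the Petersen code minimises `Σ (1 + ⟪x,y⟫)^k` for EVERY `k ≥ 7`

Framing: lottery ticket; floor = certified bounds/negative ranges. Venture `PackingBounds`, cell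
`pub-packcert`, energy family E3PT (pub-packcert-energy gen 14).

Cohn–Woo (J. AMS 2012, §5.3): "for `k ≥ 7` we can prove that [the three-point bounds] are sharp for the Petersen code (by
using the spherical analogue of Corollary 11 to reduce to a finite basis)"; no details are printed. Here the reduction is carried
out in the kernel. With the doubled node sequence `v = (1/3, 1/3, 7/6, 7/6)` in `u = 1 + t` (the Petersen inner products
`-2/3, 1/6`), the Newton expansion `u^{k-7} = Σ_{j<4} c_j ω_j(u) + r(u) ω_4(u)` has `c_j ≥ 0`, `r ≥ 0` on `u ≥ 0`
(`NewtonCert.newton_exists`) and `ω_4 = (u-1/3)²(u-7/6)² ≥ 0`, so for unit vectors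
`(1+⟪x,y⟫)^k ≥ Σ_j c_j (1+⟪x,y⟫)^7 ω_j(1+⟪x,y⟫)`, with equality at the Petersen inner products. The four basis potentials
`(1+t)^7`, `(1+t)^7(t+2/3)`, `(1+t)^7(t+2/3)²`, `(1+t)^7(t+2/3)²(t-1/6)` are minimised by the Petersen code by the kernel-checked
exact three-point certificates `TenPointCkSeven.ck7_ten_points`, `TenPointPetQ1.petq1_ten_points`, `TenPointPetQ2.petq2_ten_points`,
`TenPointPetQ3.petq3_ten_points`; summing with the weights `c_j` gives the bound `10·(3·(1/3)^k + 6·(7/6)^k)` — the Petersen code's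
own energy (`Config.PetersenCode.exists_config`) — for every `k ≥ 7`. Equality forces equality in the `k = 7` inequality (weight
`c₀ = (1/3)^{k-7} > 0`), so the rigidity and uniqueness of the `k = 7` ground state (`TenPointCkSeven.ck7_ten_points_rigid`,
`Config.PetersenCodeUnique`) transfer to every `k ≥ 7` (`petersen_ck_ten_points_rigid`, `minimisers_isometric`, `ground_state_energy`).
-/

noncomputable section

open Finset
open scoped RealInnerProductSpace

namespace Summit.Ventures.PackingBounds.Energy.TenPointPetersenAllK

open Summit.Ventures.PackingBounds.Config

/-- The doubled node sequence in `u = 1 + t`: `1/3, 1/3, 7/6, 7/6` (then `7/6` for ever, irrelevant). -/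
def node : ℕ → ℝ := fun i => if i < 2 then 1 / 3 else 7 / 6

/-- The nodes are nonnegative. -/
theorem node_nonneg (i : ℕ) : 0 ≤ node i := by
  unfold node; split_ifs <;> norm_num

/-- `ω_4(u) = (u - 1/3)² (u - 7/6)² ≥ 0`. -/
theorem omega_four_nonneg (u : ℝ) : 0 ≤ ∏ i ∈ range 4, (u - node i) := by
  have h : ∏ i ∈ range 4, (u - node i) = ((u - 1 / 3) * (u - 7 / 6)) ^ 2 := by
    simp [Finset.prod_range_succ, node]; ring
  rw [h]; exact sq_nonneg _

/-- The Newton sum written out: `Σ_{j<4} c_j ω_j(1+t) = c₀ + c₁(t+2/3) + c₂(t+2/3)² + c₃(t+2/3)²(t-1/6)`. -/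
theorem newton_sum_eq (c : ℕ → ℝ) (t : ℝ) :
    ∑ j ∈ range 4, c j * ∏ i ∈ range j, (1 + t - node i)
      = c 0 + c 1 * (t + 2 / 3) + c 2 * (t + 2 / 3) ^ 2 + c 3 * ((t + 2 / 3) ^ 2 * (t - 1 / 6)) := by
  simp [Finset.sum_range_succ, Finset.prod_range_succ, node]
  ring

/-- **The Petersen code minimises the `(1+t)^k`-energy of ten points on `S³` for every `k ≥ 7`.** For every ten unit vectors
`C ⊂ ℝ⁴` and every `k ≥ 7`: `Σ_{x ≠ y} (1 + ⟪x,y⟫)^k ≥ 10·(3·(1/3)^k + 6·(7/6)^k)`, the value of the Petersen code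
(inner products `-2/3` three times and `1/6` six times around each point). -/
theorem petersen_ck_ten_points (k : ℕ) (hk : 7 ≤ k) (C : Finset (EuclideanSpace ℝ (Fin 4)))
    (hC : ∀ x ∈ C, ‖x‖ = 1) (h10 : C.card = 10) :
    (10 : ℝ) * (3 * (1 / 3 : ℝ) ^ k + 6 * (7 / 6 : ℝ) ^ k) ≤ ∑ x ∈ C, ∑ y ∈ C.erase x, (1 + inner ℝ x y) ^ k := by
  classical
  obtain ⟨c, r, hc, hr, hexp⟩ := NewtonCert.newton_exists node node_nonneg 4 (by norm_num) (k - 7)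
  -- pointwise: (1+t)^k ≥ Σ_j c_j (1+t)^7 ω_j(1+t) for t = ⟪x,y⟫ of unit vectors
  have hpt : ∀ x ∈ C, ∀ y ∈ C.erase x,
      c 0 * (1 + inner ℝ x y) ^ 7 + c 1 * ((1 + inner ℝ x y) ^ 7 * (inner ℝ x y + 2 / 3))
        + c 2 * ((1 + inner ℝ x y) ^ 7 * (inner ℝ x y + 2 / 3) ^ 2)
        + c 3 * ((1 + inner ℝ x y) ^ 7 * (inner ℝ x y + 2 / 3) ^ 2 * (inner ℝ x y - 1 / 6))
        ≤ (1 + inner ℝ x y) ^ k := by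
    intro x hx y hy
    set t := inner ℝ x y with ht
    have hyC : y ∈ C := Finset.mem_of_mem_erase hy
    have hu : 0 ≤ 1 + t := by
      have := neg_one_le_real_inner_of_norm_eq_one (hC x hx) (hC y hyC); linarith
    have hk' : k = 7 + (k - 7) := by omega
    have hmain : (1 + t) ^ k = (1 + t) ^ 7 * (∑ j ∈ range 4, c j * ∏ i ∈ range j, (1 + t - node i))
        + (1 + t) ^ 7 * (r (1 + t) * ∏ i ∈ range 4, (1 + t - node i)) := by
      rw [hk', pow_add, hexp (1 + t)]; ring
    have hrem : 0 ≤ (1 + t) ^ 7 * (r (1 + t) * ∏ i ∈ range 4, (1 + t - node i)) :=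
      mul_nonneg (pow_nonneg hu 7) (mul_nonneg (hr _ hu) (omega_four_nonneg _))
    rw [newton_sum_eq] at hmain
    nlinarith [hmain, hrem]
  -- sum over ordered pairs of distinct points
  have hsum := Finset.sum_le_sum fun x hx => Finset.sum_le_sum fun y hy => hpt x hx y hy
  have h7 := TenPointCkSeven.ck7_ten_points C hC h10
  have h1 := TenPointPetQ1.petq1_ten_points C hC h10
  have h2 := TenPointPetQ2.petq2_ten_points C hC h10
  have h3 := TenPointPetQ3.petq3_ten_points C hC h10
  -- the weighted sum of the four bounds is the Petersen value: evaluate the Newton expansion at the two nodes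
  have e1 := hexp (1 / 3)
  have e2 := hexp (7 / 6)
  rw [show (1 / 3 : ℝ) = 1 + (-2 / 3) by norm_num, newton_sum_eq] at e1
  rw [show (7 / 6 : ℝ) = 1 + (1 / 6) by norm_num, newton_sum_eq] at e2
  have w1 : ∏ i ∈ range 4, (1 + (-2 / 3 : ℝ) - node i) = 0 := by simp [Finset.prod_range_succ, node]; norm_num
  have w2 : ∏ i ∈ range 4, (1 + (1 / 6 : ℝ) - node i) = 0 := by simp [Finset.prod_range_succ, node]; norm_num
  rw [w1, mul_zero, add_zero] at e1
  rw [w2, mul_zero, add_zero] at e2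
  have hk' : k = 7 + (k - 7) := by omega
  have hval : (10 : ℝ) * (3 * (1 / 3 : ℝ) ^ k + 6 * (7 / 6 : ℝ) ^ k)
      = c 0 * ((4118035 : ℝ) / 23328) + c 1 * ((20588575 : ℝ) / 139968) + c 2 * ((102942875 : ℝ) / 839808) + c 3 * 0 := by
    rw [hk', pow_add, pow_add, show (1 / 3 : ℝ) = 1 + (-2 / 3) by norm_num, show (7 / 6 : ℝ) = 1 + (1 / 6) by norm_num, e1, e2]
    norm_num; ring
  have hsplit : ∑ x ∈ C, ∑ y ∈ C.erase x,
      (c 0 * (1 + inner ℝ x y) ^ 7 + c 1 * ((1 + inner ℝ x y) ^ 7 * (inner ℝ x y + 2 / 3))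
        + c 2 * ((1 + inner ℝ x y) ^ 7 * (inner ℝ x y + 2 / 3) ^ 2)
        + c 3 * ((1 + inner ℝ x y) ^ 7 * (inner ℝ x y + 2 / 3) ^ 2 * (inner ℝ x y - 1 / 6)))
      = c 0 * ∑ x ∈ C, ∑ y ∈ C.erase x, (1 + inner ℝ x y) ^ 7
        + c 1 * ∑ x ∈ C, ∑ y ∈ C.erase x, (1 + inner ℝ x y) ^ 7 * (inner ℝ x y + 2 / 3)
        + c 2 * ∑ x ∈ C, ∑ y ∈ C.erase x, (1 + inner ℝ x y) ^ 7 * (inner ℝ x y + 2 / 3) ^ 2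
        + c 3 * ∑ x ∈ C, ∑ y ∈ C.erase x, (1 + inner ℝ x y) ^ 7 * (inner ℝ x y + 2 / 3) ^ 2 * (inner ℝ x y - 1 / 6) := by
    simp only [Finset.sum_add_distrib, Finset.mul_sum]
  rw [hsplit] at hsum
  rw [hval]
  have hc0 := hc 0; have hc1 := hc 1; have hc2 := hc 2; have hc3 := hc 3
  nlinarith [hsum, mul_le_mul_of_nonneg_left h7 hc0, mul_le_mul_of_nonneg_left h1 hc1,
    mul_le_mul_of_nonneg_left h2 hc2, mul_le_mul_of_nonneg_left h3 hc3]

/-- **Rigidity, all `k ≥ 7`.** If ten unit vectors of `ℝ⁴` attain the Petersen value of the `(1+t)^k`-energy (`k ≥ 7`), then every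
inner product of two distinct points is `1/6` or `-2/3`: equality forces equality in the `k = 7` basis inequality (its Newton weight is
`c₀ = (1/3)^{k-7} > 0`), and `TenPointCkSeven.ck7_ten_points_rigid` applies. -/
theorem petersen_ck_ten_points_rigid (k : ℕ) (hk : 7 ≤ k) (C : Finset (EuclideanSpace ℝ (Fin 4)))
    (hC : ∀ x ∈ C, ‖x‖ = 1) (h10 : C.card = 10)
    (hmin : ∑ x ∈ C, ∑ y ∈ C.erase x, (1 + inner ℝ x y) ^ k = (10 : ℝ) * (3 * (1 / 3 : ℝ) ^ k + 6 * (7 / 6 : ℝ) ^ k)) :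
    ∀ x ∈ C, ∀ y ∈ C, x ≠ y → inner ℝ x y = 1 / 6 ∨ inner ℝ x y = -2 / 3 := by
  classical
  obtain ⟨c, r, hc, hr, hexp⟩ := NewtonCert.newton_exists node node_nonneg 4 (by norm_num) (k - 7)
  have hpt : ∀ x ∈ C, ∀ y ∈ C.erase x,
      c 0 * (1 + inner ℝ x y) ^ 7 + c 1 * ((1 + inner ℝ x y) ^ 7 * (inner ℝ x y + 2 / 3))
        + c 2 * ((1 + inner ℝ x y) ^ 7 * (inner ℝ x y + 2 / 3) ^ 2)
        + c 3 * ((1 + inner ℝ x y) ^ 7 * (inner ℝ x y + 2 / 3) ^ 2 * (inner ℝ x y - 1 / 6))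
        ≤ (1 + inner ℝ x y) ^ k := by
    intro x hx y hy
    set t := inner ℝ x y with ht
    have hyC : y ∈ C := Finset.mem_of_mem_erase hy
    have hu : 0 ≤ 1 + t := by
      have := neg_one_le_real_inner_of_norm_eq_one (hC x hx) (hC y hyC); linarith
    have hk' : k = 7 + (k - 7) := by omega
    have hmain : (1 + t) ^ k = (1 + t) ^ 7 * (∑ j ∈ range 4, c j * ∏ i ∈ range j, (1 + t - node i))
        + (1 + t) ^ 7 * (r (1 + t) * ∏ i ∈ range 4, (1 + t - node i)) := by
      rw [hk', pow_add, hexp (1 + t)]; ring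
    have hrem : 0 ≤ (1 + t) ^ 7 * (r (1 + t) * ∏ i ∈ range 4, (1 + t - node i)) :=
      mul_nonneg (pow_nonneg hu 7) (mul_nonneg (hr _ hu) (omega_four_nonneg _))
    rw [newton_sum_eq] at hmain
    nlinarith [hmain, hrem]
  have hsum := Finset.sum_le_sum fun x hx => Finset.sum_le_sum fun y hy => hpt x hx y hy
  have h7 := TenPointCkSeven.ck7_ten_points C hC h10
  have h1 := TenPointPetQ1.petq1_ten_points C hC h10
  have h2 := TenPointPetQ2.petq2_ten_points C hC h10
  have h3 := TenPointPetQ3.petq3_ten_points C hC h10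
  have e1 := hexp (1 / 3)
  have e2 := hexp (7 / 6)
  rw [show (1 / 3 : ℝ) = 1 + (-2 / 3) by norm_num, newton_sum_eq] at e1
  rw [show (7 / 6 : ℝ) = 1 + (1 / 6) by norm_num, newton_sum_eq] at e2
  have w1 : ∏ i ∈ range 4, (1 + (-2 / 3 : ℝ) - node i) = 0 := by simp [Finset.prod_range_succ, node]; norm_num
  have w2 : ∏ i ∈ range 4, (1 + (1 / 6 : ℝ) - node i) = 0 := by simp [Finset.prod_range_succ, node]; norm_num
  rw [w1, mul_zero, add_zero] at e1
  rw [w2, mul_zero, add_zero] at e2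
  have hk' : k = 7 + (k - 7) := by omega
  have hval : (10 : ℝ) * (3 * (1 / 3 : ℝ) ^ k + 6 * (7 / 6 : ℝ) ^ k)
      = c 0 * ((4118035 : ℝ) / 23328) + c 1 * ((20588575 : ℝ) / 139968) + c 2 * ((102942875 : ℝ) / 839808) + c 3 * 0 := by
    rw [hk', pow_add, pow_add, show (1 / 3 : ℝ) = 1 + (-2 / 3) by norm_num, show (7 / 6 : ℝ) = 1 + (1 / 6) by norm_num, e1, e2]
    norm_num; ring
  -- the Newton weight of the k = 7 basis function is (1/3)^(k-7) > 0
  have hc0 : c 0 = (1 + (-2 / 3 : ℝ)) ^ (k - 7) := by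
    rw [e1]; norm_num
  have hc0pos : 0 < c 0 := by rw [hc0]; positivity
  have hsplit : ∑ x ∈ C, ∑ y ∈ C.erase x,
      (c 0 * (1 + inner ℝ x y) ^ 7 + c 1 * ((1 + inner ℝ x y) ^ 7 * (inner ℝ x y + 2 / 3))
        + c 2 * ((1 + inner ℝ x y) ^ 7 * (inner ℝ x y + 2 / 3) ^ 2)
        + c 3 * ((1 + inner ℝ x y) ^ 7 * (inner ℝ x y + 2 / 3) ^ 2 * (inner ℝ x y - 1 / 6)))
      = c 0 * ∑ x ∈ C, ∑ y ∈ C.erase x, (1 + inner ℝ x y) ^ 7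
        + c 1 * ∑ x ∈ C, ∑ y ∈ C.erase x, (1 + inner ℝ x y) ^ 7 * (inner ℝ x y + 2 / 3)
        + c 2 * ∑ x ∈ C, ∑ y ∈ C.erase x, (1 + inner ℝ x y) ^ 7 * (inner ℝ x y + 2 / 3) ^ 2
        + c 3 * ∑ x ∈ C, ∑ y ∈ C.erase x, (1 + inner ℝ x y) ^ 7 * (inner ℝ x y + 2 / 3) ^ 2 * (inner ℝ x y - 1 / 6) := by
    simp only [Finset.sum_add_distrib, Finset.mul_sum]
  rw [hsplit] at hsum
  have hc1 := hc 1; have hc2 := hc 2; have hc3 := hc 3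
  have hE7 : c 0 * (∑ x ∈ C, ∑ y ∈ C.erase x, (1 + inner ℝ x y) ^ 7 - (4118035 : ℝ) / 23328) = 0 := by
    nlinarith [hsum, hmin, hval, mul_le_mul_of_nonneg_left h7 hc0pos.le, mul_le_mul_of_nonneg_left h1 hc1,
      mul_le_mul_of_nonneg_left h2 hc2, mul_le_mul_of_nonneg_left h3 hc3]
  have hE7' : ∑ x ∈ C, ∑ y ∈ C.erase x, (1 + inner ℝ x y) ^ 7 = ((4118035 : ℝ)/23328) := by
    rcases mul_eq_zero.1 hE7 with h | h
    · exact absurd h hc0pos.ne'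
    · linarith
  exact TenPointCkSeven.ck7_ten_points_rigid C hC h10 hE7'

/-- **Uniqueness, all `k ≥ 7`:** any two minimisers of the `(1+t)^k`-energy of ten points on `S³` (`k ≥ 7`) are related by a linear
isometry of `ℝ⁴` (both are the Petersen code: `Config.PetersenCodeUnique.isometric`). -/
theorem minimisers_isometric (k : ℕ) (hk : 7 ≤ k) (C C' : Finset (EuclideanSpace ℝ (Fin 4)))
    (hC : ∀ x ∈ C, ‖x‖ = 1) (h10 : C.card = 10)
    (hmin : ∑ x ∈ C, ∑ y ∈ C.erase x, (1 + inner ℝ x y) ^ k = (10 : ℝ) * (3 * (1 / 3 : ℝ) ^ k + 6 * (7 / 6 : ℝ) ^ k))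
    (hC' : ∀ x ∈ C', ‖x‖ = 1) (h10' : C'.card = 10)
    (hmin' : ∑ x ∈ C', ∑ y ∈ C'.erase x, (1 + inner ℝ x y) ^ k = (10 : ℝ) * (3 * (1 / 3 : ℝ) ^ k + 6 * (7 / 6 : ℝ) ^ k)) :
    ∃ Ψ : EuclideanSpace ℝ (Fin 4) ≃ₗᵢ[ℝ] EuclideanSpace ℝ (Fin 4), C' = C.image Ψ :=
  PetersenCodeUnique.isometric hC h10 (petersen_ck_ten_points_rigid k hk C hC h10 hmin) hC' h10'
    (petersen_ck_ten_points_rigid k hk C' hC' h10' hmin')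

/-- **Ground-state energy, all `k ≥ 7`:** a minimiser has the Petersen code's distance distribution: for every pair potential `a`,
`Σ_{x≠y} a(⟪x,y⟫) = 10·(3a(-2/3) + 6a(1/6))`. -/
theorem ground_state_energy (k : ℕ) (hk : 7 ≤ k) (C : Finset (EuclideanSpace ℝ (Fin 4)))
    (hC : ∀ x ∈ C, ‖x‖ = 1) (h10 : C.card = 10)
    (hmin : ∑ x ∈ C, ∑ y ∈ C.erase x, (1 + inner ℝ x y) ^ k = (10 : ℝ) * (3 * (1 / 3 : ℝ) ^ k + 6 * (7 / 6 : ℝ) ^ k)) (a : ℝ → ℝ) :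
    ∑ x ∈ C, ∑ y ∈ C.erase x, a (inner ℝ x y) = (10 : ℝ) * (3 * a (-2 / 3) + 6 * a (1 / 6)) :=
  PetersenCodeUnique.energy_eq hC h10 (petersen_ck_ten_points_rigid k hk C hC h10 hmin) a

/-- **Two-sided, all `k ≥ 7`:** the least `(1+t)^k`-energy of ten unit vectors of `ℝ⁴` is the Petersen code's
`10·(3·(1/3)^k + 6·(7/6)^k)`. -/
theorem petersen_ck_ten_points_isLeast (k : ℕ) (hk : 7 ≤ k) :
    IsLeast {E : ℝ | ∃ C : Finset (EuclideanSpace ℝ (Fin 4)), C.card = 10 ∧ (∀ x ∈ C, ‖x‖ = 1) ∧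
      E = ∑ x ∈ C, ∑ y ∈ C.erase x, (1 + inner ℝ x y) ^ k} ((10 : ℝ) * (3 * (1 / 3 : ℝ) ^ k + 6 * (7 / 6 : ℝ) ^ k)) := by
  obtain ⟨C0, hc0, hn0, _, he0⟩ := PetersenCode.exists_config
  refine ⟨⟨C0, hc0, hn0, ?_⟩, ?_⟩
  · rw [he0 (fun t : ℝ => (1 + t) ^ k)]; norm_num
  · rintro E ⟨C, h10, hC, rfl⟩
    exact petersen_ck_ten_points k hk C hC h10

end Summit.Ventures.PackingBounds.Energy.TenPointPetersenAllK
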